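import Mathlib.Topology.MetricSpace.HolderNorm
import Mathlib.Analysis.Calculus.ContDiff.Basic
import Mathlib.MeasureTheory.Function.LpSeminorm.Basic
import Literature.Analysis.FunctionSpaces.FlatTorus
import HarnessLib

-- provenance: harness21/H21/H21/Prelude/Sobolev/HolderNorm.lean @ d967f76 (interim HEAD d8f2665); M5 mechanical rewrite
/-!
# Hölder norms and classes `C^{0,α}`, `C^{k,α}` (trunk: Sobolev, concept C8 /
notion `holder_spaces_Ck_alpha`, part 1)

Mathlib (`Mathlib.Topology.MetricSpace.HolderNorm`) provides the Hölder *seminorm*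
`eHolderNorm r f = inf {C | HolderWith C r f}`, its `ℝ≥0` version `nnHolderNorm`, and the predicate
`MemHolder r f := ∃ C, HolderWith C r f`, with algebra (`MemHolder.add/smul`,
`eHolderNorm_add_le`) under `[MetricSpace X] [NormedAddCommGroup Y]` and monotonicity in the
exponent `MemHolder.of_le` under `[PseudoMetricSpace X] [BoundedSpace X]`. We use all of these and
only add what Mathlib lacks:

* the sup norm `eSupNorm f = ⨆ x, ‖f x‖ₑ` and the *inhomogeneous* Hölder norm
  `eBoundedHolderNorm r f = eSupNorm f + eHolderNorm r f` (`‖f‖_{C^{0,α}} = ‖f‖_∞ + [f]_α`),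
  its real version `boundedHolderNorm`, and the class `MemBoundedHolder r f` (`f ∈ C^{0,α}_b`);
* `C^{k,α}` on a real normed space, `MemContDiffHolder k r f`, and its norm
  `eContDiffHolderNorm k r f = ∑_{j ≤ k} ‖D^j f‖_∞ + [D^k f]_α`;
* the torus versions `Torus.MemContDiffHolder`, `Torus.eContDiffHolderNorm` through the periodic
  lift `Torus.lift` (`Literature.Prelude.Sobolev.FlatTorus`);
* mixed space–time classes for `u : ℝ → X → Y`: `L^∞_t C^α_x` (`HolderUniformlyBoundedOn`),
  `C⁰_t C^α_x` (`ContinuousInHolderOn`), `L^p_t C^α_x` (`eLpHolderNorm`, `MemLpHolder`) and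
  `C^α_{t,x}` on `[0,T] × X` (`HolderOnSpaceTime`).

## Design choices

* Generality: `X` a `PseudoEMetricSpace`, `Y` a `NormedAddCommGroup`, exponent `r : ℝ≥0`
  (as in Mathlib; `r = α ∈ (0,1]` in applications). Note that Mathlib's `HolderWith C 0 f` is a
  mere oscillation bound `edist (f x) (f y) ≤ C`, so lemmas relating Hölder classes to continuity
  / `C⁰` carry the hypothesis `0 < r`, and `Torus.IsSmooth.memContDiffHolder` needs `r ≤ 1`.
  Lemmas invoking Mathlib's `MemHolder.add`/`MemHolder.smul` are stated under `[MetricSpace X]`,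
  where Mathlib has them.
* All norms are `ℝ≥0∞`-valued and total (value `∞` off the class), like `eLpNorm`/`eHolderNorm`;
  the real-valued `boundedHolderNorm` is `toReal` of the extended one (junk value `0` off the
  class — documented). `eLpHolderNorm` is `eLpNorm` of `t ↦ boundedHolderNorm r (u t)` and hence
  is also total: it does not see whether `u t ∈ C^{0,α}` (junk `0`) nor measurability in `t`;
  the guarded predicate `MemLpHolder` adds the a.e. membership.
* The bundled Banach space `C^{0,α}_b(X, Y)` is part 2 (`HolderSpace.lean`, C9).

## References

* D. Gilbarg, N. Trudinger, *Elliptic PDE of second order* (2001), §4.1 (Hölder spaces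
  `C^{k,α}`, norms `|u|_{k,α} = ∑_{j≤k} ‖D^j u‖_∞ + [D^k u]_α`).
* L. C. Evans, *Partial Differential Equations* (2nd ed., 2010), §5.1 (Hölder spaces).
* C. De Lellis, L. Székelyhidi, *Dissipative continuous Euler flows*, Invent. Math. 193 (2013),
  §2 (Hölder norms on `T³`, `C⁰_t C^α_x`).
-/

open Filter Set MeasureTheory Topology
open scoped NNReal ENNReal

noncomputable section

namespace Literature.Analysis.FunctionSpaces

variable {X : Type*} {Y : Type*}

/-! ## Sup norm and the inhomogeneous Hölder norm -/

section SupNorm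

variable [NormedAddCommGroup Y]

/-- The extended sup norm `‖f‖_∞ = sup_x ‖f x‖ ∈ [0, ∞]` of a function (no topology or measure on
the source; Gilbarg–Trudinger §4.1, `|u|_{0;Ω}`). Equals `0` on an empty domain. [folklore] -/
def eSupNorm (f : X → Y) : ℝ≥0∞ := ⨆ x, ‖f x‖ₑ

/-- Pointwise bound by the sup norm. [folklore] -/
theorem enorm_le_eSupNorm (f : X → Y) (x : X) : ‖f x‖ₑ ≤ eSupNorm f :=
  le_iSup (fun x => ‖f x‖ₑ) x

/-- The sup norm of `0` is `0`. [folklore] -/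
@[simp]
theorem eSupNorm_zero : eSupNorm (0 : X → Y) = 0 := by
  simp [eSupNorm]

/-- The sup norm is finite iff the function is bounded (Gilbarg–Trudinger §4.1). [folklore] -/
theorem eSupNorm_lt_top_iff {f : X → Y} : eSupNorm f < ∞ ↔ ∃ C : ℝ, ∀ x, ‖f x‖ ≤ C := by
  constructor
  · intro h
    refine ⟨(eSupNorm f).toReal, fun x => ?_⟩
    have hx : ‖f x‖ₑ ≤ eSupNorm f := enorm_le_eSupNorm f x
    have := ENNReal.toReal_mono h.ne hx
    simpa using this
  · rintro ⟨C, hC⟩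
    refine lt_of_le_of_lt (iSup_le fun x => ?_) (ENNReal.ofReal_lt_top (r := C))
    rw [← ofReal_norm]
    exact ENNReal.ofReal_le_ofReal (hC x)

/-- Triangle inequality for the sup norm. [folklore] -/
theorem eSupNorm_add_le (f g : X → Y) : eSupNorm (f + g) ≤ eSupNorm f + eSupNorm g := by
  refine iSup_le fun x => ?_
  exact (enorm_add_le _ _).trans (add_le_add (enorm_le_eSupNorm f x) (enorm_le_eSupNorm g x))

/-- The sup norm is invariant under negation. [folklore] -/
@[simp]
theorem eSupNorm_neg (f : X → Y) : eSupNorm (-f) = eSupNorm f := by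
  simp [eSupNorm]

end SupNorm

section BoundedHolder

variable [PseudoEMetricSpace X] [NormedAddCommGroup Y]

/-- The extended inhomogeneous Hölder norm `‖f‖_{C^{0,r}} = ‖f‖_∞ + [f]_r ∈ [0, ∞]`, where
`[f]_r = eHolderNorm r f` is Mathlib's Hölder seminorm (Gilbarg–Trudinger §4.1, eq. (4.4) with
`k = 0`; Evans §5.1). [folklore] -/
def eBoundedHolderNorm (r : ℝ≥0) (f : X → Y) : ℝ≥0∞ := eSupNorm f + eHolderNorm r f

/-- The real inhomogeneous Hölder norm `‖f‖_{C^{0,r}} = ‖f‖_∞ + [f]_r`, the `toReal` of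
`eBoundedHolderNorm` (junk value `0` when `f ∉ C^{0,r}_b`) (Gilbarg–Trudinger §4.1). [folklore] -/
def boundedHolderNorm (r : ℝ≥0) (f : X → Y) : ℝ := (eBoundedHolderNorm r f).toReal

/-- Membership in the bounded Hölder class `C^{0,r}_b(X, Y)`: `‖f‖_∞ + [f]_r < ∞`
(Gilbarg–Trudinger §4.1; Evans §5.1). [folklore] -/
def MemBoundedHolder (r : ℝ≥0) (f : X → Y) : Prop := eBoundedHolderNorm r f < ∞

variable {r : ℝ≥0} {f g : X → Y}

/-- Unfolding `eBoundedHolderNorm`. [folklore] -/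
theorem eBoundedHolderNorm_def (r : ℝ≥0) (f : X → Y) :
    eBoundedHolderNorm r f = eSupNorm f + eHolderNorm r f := rfl

/-- The sup norm is bounded by the inhomogeneous Hölder norm. [folklore] -/
theorem eSupNorm_le_eBoundedHolderNorm (r : ℝ≥0) (f : X → Y) :
    eSupNorm f ≤ eBoundedHolderNorm r f :=
  le_self_add

/-- The Hölder seminorm is bounded by the inhomogeneous Hölder norm. [folklore] -/
theorem eHolderNorm_le_eBoundedHolderNorm (r : ℝ≥0) (f : X → Y) :
    eHolderNorm r f ≤ eBoundedHolderNorm r f :=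
  le_add_self

/-- The inhomogeneous Hölder norm of `0` vanishes. [folklore] -/
@[simp]
theorem eBoundedHolderNorm_zero (r : ℝ≥0) : eBoundedHolderNorm r (0 : X → Y) = 0 := by
  simp [eBoundedHolderNorm, eHolderNorm_zero]

/-- `f ∈ C^{0,r}_b` iff `f` is bounded and `r`-Hölder (Gilbarg–Trudinger §4.1). [folklore] -/
theorem memBoundedHolder_iff :
    MemBoundedHolder r f ↔ (∃ C : ℝ, ∀ x, ‖f x‖ ≤ C) ∧ MemHolder r f := by
  rw [MemBoundedHolder, eBoundedHolderNorm, ENNReal.add_lt_top, eSupNorm_lt_top_iff,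
    eHolderNorm_lt_top]

/-- Functions in `C^{0,r}_b` are `r`-Hölder. [folklore] -/
theorem MemBoundedHolder.memHolder (hf : MemBoundedHolder r f) : MemHolder r f :=
  (memBoundedHolder_iff.1 hf).2

/-- Functions in `C^{0,r}_b` are bounded. [folklore] -/
theorem MemBoundedHolder.eSupNorm_lt_top (hf : MemBoundedHolder r f) : eSupNorm f < ∞ :=
  (ENNReal.add_lt_top.1 hf).1

/-- Functions in `C^{0,r}_b` have finite norm. [folklore] -/
theorem MemBoundedHolder.eBoundedHolderNorm_lt_top (hf : MemBoundedHolder r f) :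
    eBoundedHolderNorm r f < ∞ :=
  hf

/-- For `f ∈ C^{0,r}_b` the real norm coerces back to the extended norm. [folklore] -/
theorem MemBoundedHolder.ofReal_boundedHolderNorm (hf : MemBoundedHolder r f) :
    ENNReal.ofReal (boundedHolderNorm r f) = eBoundedHolderNorm r f :=
  ENNReal.ofReal_toReal hf.ne

/-- The zero function is in `C^{0,r}_b`. [folklore] -/
theorem memBoundedHolder_zero : MemBoundedHolder r (0 : X → Y) := by
  simp [MemBoundedHolder]

/-- Hölder functions with `0 < r` are (uniformly) continuous, hence so are `C^{0,r}_b` functions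
(Evans §5.1). For `r = 0` the Hölder condition is a mere oscillation bound, so `0 < r` is needed. [folklore] -/
theorem MemBoundedHolder.continuous (hf : MemBoundedHolder r f) (hr : 0 < r) : Continuous f := by
  obtain ⟨C, hC⟩ := hf.memHolder
  exact hC.continuous hr

/-- `C^{0,r}_b` is closed under negation. [folklore] -/
theorem MemBoundedHolder.neg (hf : MemBoundedHolder r f) : MemBoundedHolder r (-f) := by
  refine memBoundedHolder_iff.2 ⟨?_, ?_⟩
  · obtain ⟨C, hC⟩ := (memBoundedHolder_iff.1 hf).1
    exact ⟨C, fun x => by simpa using hC x⟩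
  · obtain ⟨C, hC⟩ := hf.memHolder
    refine ⟨C, fun x y => ?_⟩
    rw [edist_eq_enorm_sub, Pi.neg_apply, Pi.neg_apply, neg_sub_neg, enorm_sub_rev,
      ← edist_eq_enorm_sub]
    exact hC x y

/-- On a compact space every `r`-Hölder function (`0 < r`) is bounded, hence in `C^{0,r}_b`
(Gilbarg–Trudinger §4.1: on compact `Ω̄` the spaces `C^{0,α}(Ω̄)` are automatically bounded).
Deliberately stated in Mathlib's `MemHolder` namespace for dot notation. [folklore] -/
theorem _root_.MemHolder.memBoundedHolder_of_compactSpace [CompactSpace X] (hf : MemHolder r f)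
    (hr : 0 < r) : MemBoundedHolder r f := by
  refine memBoundedHolder_iff.2 ⟨?_, hf⟩
  obtain ⟨C, hC⟩ := hf
  have hcont : Continuous fun x => ‖f x‖ := (hC.continuous hr).norm
  obtain ⟨M, hM⟩ := (isCompact_univ.image hcont).isBounded.bddAbove
  exact ⟨M, fun x => hM ⟨x, mem_univ _, rfl⟩⟩

end BoundedHolder

section Monotonicity

variable [PseudoMetricSpace X] [BoundedSpace X] [NormedAddCommGroup Y] {r r' : ℝ≥0} {f : X → Y}

/-- On a bounded (pseudo)metric space, `C^{0,r}_b ⊆ C^{0,r'}_b` for `r' ≤ r`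
(Gilbarg–Trudinger §4.1). Derived from Mathlib's `MemHolder.of_le`. [folklore] -/
theorem MemBoundedHolder.of_le (hf : MemBoundedHolder r f) (h : r' ≤ r) :
    MemBoundedHolder r' f :=
  memBoundedHolder_iff.2 ⟨(memBoundedHolder_iff.1 hf).1, hf.memHolder.of_le h⟩

end Monotonicity

section Algebra

variable [MetricSpace X] [NormedAddCommGroup Y] {r : ℝ≥0} {f g : X → Y}

/-- `C^{0,r}_b` is closed under addition (Mathlib `MemHolder.add`, `[MetricSpace X]`). [folklore] -/
theorem MemBoundedHolder.add (hf : MemBoundedHolder r f) (hg : MemBoundedHolder r g) :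
    MemBoundedHolder r (f + g) := by
  refine memBoundedHolder_iff.2 ⟨?_, hf.memHolder.add hg.memHolder⟩
  obtain ⟨C, hC⟩ := (memBoundedHolder_iff.1 hf).1
  obtain ⟨D, hD⟩ := (memBoundedHolder_iff.1 hg).1
  exact ⟨C + D, fun x => (norm_add_le _ _).trans (add_le_add (hC x) (hD x))⟩

/-- `C^{0,r}_b` is closed under subtraction. [folklore] -/
theorem MemBoundedHolder.sub (hf : MemBoundedHolder r f) (hg : MemBoundedHolder r g) :
    MemBoundedHolder r (f - g) := by
  simpa [sub_eq_add_neg] using hf.add hg.neg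

/-- Triangle inequality for the inhomogeneous Hölder norm (from `eHolderNorm_add_le`). [folklore] -/
theorem eBoundedHolderNorm_add_le (f g : X → Y) :
    eBoundedHolderNorm r (f + g) ≤ eBoundedHolderNorm r f + eBoundedHolderNorm r g := by
  calc eBoundedHolderNorm r (f + g)
      ≤ (eSupNorm f + eSupNorm g) + (eHolderNorm r f + eHolderNorm r g) :=
        add_le_add (eSupNorm_add_le f g) eHolderNorm_add_le
    _ = eBoundedHolderNorm r f + eBoundedHolderNorm r g := by
        simp only [eBoundedHolderNorm]; abel

/-- `C^{0,r}_b` is closed under scalar multiplication (Mathlib `MemHolder.smul`). [folklore] -/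
theorem MemBoundedHolder.smul {𝕜 : Type*} [SeminormedRing 𝕜] [Module 𝕜 Y] [IsBoundedSMul 𝕜 Y]
    (c : 𝕜) (hf : MemBoundedHolder r f) : MemBoundedHolder r (c • f) := by
  refine memBoundedHolder_iff.2 ⟨?_, hf.memHolder.smul⟩
  obtain ⟨C, hC⟩ := (memBoundedHolder_iff.1 hf).1
  exact ⟨‖c‖ * C, fun x => (norm_smul_le c (f x)).trans (by gcongr; exact hC x)⟩

end Algebra

/-! ## The classes `C^{k,α}` on a real normed space -/

section ContDiffHolder

variable {E' : Type*} [NormedAddCommGroup E'] [NormedSpace ℝ E'] [NormedAddCommGroup Y]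
  [NormedSpace ℝ Y]

/-- Membership in `C^{k,r}_b(E', Y)` on a real normed space `E'`: `f` is `C^k`, all derivatives
`D^j f`, `j ≤ k`, are bounded, and `D^k f` is `r`-Hölder (Gilbarg–Trudinger §4.1; Evans §5.1,
definition of `C^{k,γ}(Ū)`). Derivatives are Mathlib's `iteratedFDeriv ℝ j f`. [folklore] -/
def MemContDiffHolder (k : ℕ) (r : ℝ≥0) (f : E' → Y) : Prop :=
  ContDiff ℝ k f ∧ (∀ j ≤ k, eSupNorm (iteratedFDeriv ℝ j f) < ∞) ∧
    MemHolder r (iteratedFDeriv ℝ k f)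

/-- The extended `C^{k,r}` norm `‖f‖_{C^{k,r}} = ∑_{j ≤ k} ‖D^j f‖_∞ + [D^k f]_r ∈ [0, ∞]`
(Gilbarg–Trudinger §4.1, eq. (4.4); Evans §5.1). Total: no differentiability is assumed
(`iteratedFDeriv` has junk values off `C^k`). [folklore] -/
def eContDiffHolderNorm (k : ℕ) (r : ℝ≥0) (f : E' → Y) : ℝ≥0∞ :=
  (∑ j ∈ Finset.range (k + 1), eSupNorm (iteratedFDeriv ℝ j f)) +
    eHolderNorm r (iteratedFDeriv ℝ k f)

variable {k : ℕ} {r : ℝ≥0} {f : E' → Y}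

/-- `C^{k,r}` functions are `C^k`. [folklore] -/
theorem MemContDiffHolder.contDiff (hf : MemContDiffHolder k r f) : ContDiff ℝ k f := hf.1

/-- The top derivative of a `C^{k,r}` function is `r`-Hölder. [folklore] -/
theorem MemContDiffHolder.memHolder_iteratedFDeriv (hf : MemContDiffHolder k r f) :
    MemHolder r (iteratedFDeriv ℝ k f) :=
  hf.2.2

/-- `C^{k,r}` functions have finite `C^{k,r}` norm. [folklore] -/
theorem MemContDiffHolder.eContDiffHolderNorm_lt_top (hf : MemContDiffHolder k r f) :
    eContDiffHolderNorm k r f < ∞ := by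
  refine ENNReal.add_lt_top.2 ⟨?_, eHolderNorm_lt_top.2 hf.2.2⟩
  refine ENNReal.sum_lt_top.2 fun j hj => hf.2.1 j ?_
  simpa [Finset.mem_range, Nat.lt_succ_iff] using hj

/-- The `0`-th derivative `D⁰ f = (continuousMultilinearCurryFin0 ℝ E' Y).symm ∘ f` has the same
sup norm as `f`. [folklore] -/
theorem eSupNorm_iteratedFDeriv_zero (f : E' → Y) :
    eSupNorm (iteratedFDeriv ℝ 0 f) = eSupNorm f := by
  simp only [eSupNorm, ← ofReal_norm, norm_iteratedFDeriv_zero]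

/-- The `0`-th derivative `D⁰ f` is `r`-Hölder with constant `C` iff `f` is (composition with a
linear isometry equivalence). [folklore] -/
theorem holderWith_iteratedFDeriv_zero_iff {C : ℝ≥0} :
    HolderWith C r (iteratedFDeriv ℝ 0 f) ↔ HolderWith C r f := by
  simp only [HolderWith, iteratedFDeriv_zero_eq_comp, Function.comp_apply,
    LinearIsometryEquiv.edist_map]

/-- The `0`-th derivative `D⁰ f` is `r`-Hölder iff `f` is. [folklore] -/
theorem memHolder_iteratedFDeriv_zero_iff : MemHolder r (iteratedFDeriv ℝ 0 f) ↔ MemHolder r f :=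
  exists_congr fun _ => holderWith_iteratedFDeriv_zero_iff

/-- For `0 < r`, `C^{0,r}` in the sense of `MemContDiffHolder` is `C^{0,r}_b` in the sense of
`MemBoundedHolder` (the `0`-th derivative is `f` up to a linear isometry, and `r`-Hölder functions
with `0 < r` are continuous). The hypothesis `0 < r` is needed: for `r = 0` the Hölder condition
is a mere oscillation bound, so a bounded discontinuous `f` is in `MemBoundedHolder 0` but not
`C⁰` (Gilbarg–Trudinger §4.1). [folklore] -/
theorem memContDiffHolder_zero_iff (hr : 0 < r) :
    MemContDiffHolder 0 r f ↔ MemBoundedHolder r f := by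
  rw [MemContDiffHolder, memHolder_iteratedFDeriv_zero_iff, MemBoundedHolder, eBoundedHolderNorm,
    ENNReal.add_lt_top, eHolderNorm_lt_top]
  constructor
  · rintro ⟨-, hsup, hH⟩
    exact ⟨(eSupNorm_iteratedFDeriv_zero f) ▸ hsup 0 le_rfl, hH⟩
  · rintro ⟨hsup, hH⟩
    obtain ⟨C, hC⟩ := hH
    refine ⟨?_, fun j hj => ?_, ⟨C, hC⟩⟩
    · exact_mod_cast contDiff_zero.2 (hC.continuous hr)
    · obtain rfl := Nat.le_zero.1 hj
      rwa [eSupNorm_iteratedFDeriv_zero]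

end ContDiffHolder

/-! ## Hölder classes on the flat torus -/

namespace Torus

variable {d : Type*} [Fintype d] [NormedAddCommGroup Y] [NormedSpace ℝ Y]

/-- Membership in `C^{k,r}(T^d, Y)`: the periodic lift `Torus.lift f : ℝ^d → Y` is in
`C^{k,r}_b(ℝ^d, Y)` (De Lellis–Székelyhidi 2013, §2; Grafakos §3.1 for functions on `T^d` as
periodic functions). [cite: LellisSzekelyhidi2013, §2] -/
def MemContDiffHolder (k : ℕ) (r : ℝ≥0) (f : UnitAddTorus d → Y) : Prop :=
  Literature.Analysis.FunctionSpaces.MemContDiffHolder k r (Torus.lift f)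

/-- The `C^{k,r}(T^d)` norm of `f`, i.e. the `C^{k,r}` norm of its periodic lift
(De Lellis–Székelyhidi 2013, §2). [cite: LellisSzekelyhidi2013, §2] -/
def eContDiffHolderNorm (k : ℕ) (r : ℝ≥0) (f : UnitAddTorus d → Y) : ℝ≥0∞ :=
  Literature.Analysis.FunctionSpaces.eContDiffHolderNorm k r (Torus.lift f)

variable {k : ℕ} {r : ℝ≥0} {f : UnitAddTorus d → Y}

/-- For `0 < r`, `C^{0,r}(T^d)` via the Euclidean lift coincides with `C^{0,r}_b(T^d)` for the
intrinsic (product/sup) metric of `UnitAddTorus d = d → AddCircle 1`. Why this is true: `proj`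
is `1`-Lipschitz and a local isometry up to constants, so for `0 < r ≤ 1` the two Hölder
seminorms are equivalent with constants depending only on `Fintype.card d` and `r` (Euclidean vs
sup norm on `ℝ^d`, and increments of sup-distance `≥ 1/2` are controlled by `2 ‖f‖_∞`); for
`r > 1` both classes consist of the constant functions only (`ℝ^d` and `T^d` are connected), and
boundedness transfers since `lift f` and `f` have the same range. The hypothesis `0 < r` is
needed: for `r = 0` a bounded discontinuous `f` is in `MemBoundedHolder 0` while `lift f` is not
continuous (`Torus.continuous_lift_iff`), hence not `C⁰` (De Lellis–Székelyhidi 2013, §2).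
[cite: DeLellisSzekelyhidiInvent2013, §2 (Hölder spaces on the torus)] -/
def memContDiffHolder_zero_iff : Prop :=
  ∀ {r : ℝ≥0} {f : UnitAddTorus d → Y}, 0 < r →
    (MemContDiffHolder 0 r f ↔ MemBoundedHolder r f)

/-- Smooth functions on the torus are `C^{k,r}` for every `k` and every `r ≤ 1` (periodic smooth
functions have bounded derivatives of all orders, and a bounded `C¹` map is Lipschitz, hence
`r`-Hölder for `r ≤ 1` on bounded increments and trivially for large increments). An elementary
consequence of the definitions, recorded as a fact pending its proof (librarian SWEEP debt); the
Hölder-space conventions are those of De Lellis–Székelyhidi 2013, §2.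
[cite: DeLellisSzekelyhidiInvent2013, §2 (Hölder spaces on the torus)] -/
def IsSmooth.memContDiffHolder : Prop :=
  ∀ {r : ℝ≥0} {f : UnitAddTorus d → Y}, IsSmooth f → ∀ k : ℕ, r ≤ 1 →
    MemContDiffHolder k r f

/-- `C^{k,r}(T^d)` functions are `C^k` on the torus. [folklore] -/
theorem MemContDiffHolder.isContDiff (hf : MemContDiffHolder k r f) : IsContDiff k f :=
  hf.1

end Torus

/-! ## Space–time Hölder classes for time-dependent fields -/

section SpaceTime

variable [PseudoEMetricSpace X] [NormedAddCommGroup Y]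

/-- `u ∈ L^∞_t C^{0,r}_x` on the time set `S`: the Hölder norms `‖u t‖_{C^{0,r}}` are uniformly
bounded for `t ∈ S` (De Lellis–Székelyhidi 2013, §2). [cite: LellisSzekelyhidi2013, §2] -/
def HolderUniformlyBoundedOn (S : Set ℝ) (r : ℝ≥0) (u : ℝ → X → Y) : Prop :=
  ⨆ t ∈ S, eBoundedHolderNorm r (u t) < ∞

/-- `u ∈ C⁰_t C^{0,r}_x` on the time set `S` ("continuous in the Hölder norm on `S`"): each
`u t ∈ C^{0,r}_b` and `t ↦ u t` is continuous on `S` for the `C^{0,r}` norm, i.e.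
`‖u t - u t₀‖_{C^{0,r}} → 0` as `t → t₀` within `S` (De Lellis–Székelyhidi 2013, §2,
`C(I; C^α(T³))`). [cite: LellisSzekelyhidi2013, §2   C(I] -/
def ContinuousInHolderOn (S : Set ℝ) (r : ℝ≥0) (u : ℝ → X → Y) : Prop :=
  (∀ t ∈ S, MemBoundedHolder r (u t)) ∧
    ∀ t₀ ∈ S, Tendsto (fun t => eBoundedHolderNorm r (u t - u t₀)) (𝓝[S] t₀) (𝓝 0)

/-- The `L^p_t C^{0,r}_x` norm on the time set `S`: `‖ t ↦ ‖u t‖_{C^{0,r}} ‖_{L^p(S)}`, as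
Mathlib's (total) `eLpNorm` of `t ↦ boundedHolderNorm r (u t)` for `volume.restrict S`.
Junk: `boundedHolderNorm` is `0` where `u t ∉ C^{0,r}_b`, and `eLpNorm` assumes no
measurability; use the guarded predicate `MemLpHolder`. (Constantin–E–Titi 1994 use
`L³_t B^α_{3,∞}`; the Hölder analogue `L^p_t C^α_x` appears e.g. in Cheskidov–Constantin–
Friedlander–Shvydkoy 2008, §1.) [cite: Titi1994, use  L³_t B^α_{3 ∞}] -/
def eLpHolderNorm (p : ℝ≥0∞) (r : ℝ≥0) (u : ℝ → X → Y) (S : Set ℝ) : ℝ≥0∞ :=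
  eLpNorm (fun t => boundedHolderNorm r (u t)) p (volume.restrict S)

/-- `u ∈ L^p_t C^{0,r}_x` on `S` (guarded): `u t ∈ C^{0,r}_b` for a.e. `t ∈ S` and the
`L^p_t C^{0,r}_x` norm is finite. [folklore] -/
def MemLpHolder (p : ℝ≥0∞) (r : ℝ≥0) (u : ℝ → X → Y) (S : Set ℝ) : Prop :=
  (∀ᵐ t ∂(volume.restrict S), MemBoundedHolder r (u t)) ∧ eLpHolderNorm p r u S < ∞

/-- Space–time Hölder continuity `u ∈ C^r([0,T] × X)`: `(t, x) ↦ u t x` is `r`-Hölder on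
`[0,T] × X` for the product (sup) extended metric on `ℝ × X`
(Constantin–E–Titi 1994 / Onsager: `C^α` in space–time). Intended for `0 ≤ T` (indeed `0 < T`);
for `T < 0` the set `[0,T]` is empty and the predicate holds vacuously. [cite: Titi1994, / Onsager:  C^α  in space–time] -/
def HolderOnSpaceTime (r : ℝ≥0) (T : ℝ) (u : ℝ → X → Y) : Prop :=
  ∃ C, HolderOnWith C r (Function.uncurry u) (Icc 0 T ×ˢ univ)

variable {S : Set ℝ} {r : ℝ≥0} {u : ℝ → X → Y}

/-- Fields continuous in the Hölder norm are pointwise in `C^{0,r}_b`. [folklore] -/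
theorem ContinuousInHolderOn.memBoundedHolder (hu : ContinuousInHolderOn S r u) {t : ℝ}
    (ht : t ∈ S) : MemBoundedHolder r (u t) :=
  hu.1 t ht

/-- `L^∞_t C^{0,r}_x` fields are pointwise in `C^{0,r}_b` on `S`. [folklore] -/
theorem HolderUniformlyBoundedOn.memBoundedHolder (hu : HolderUniformlyBoundedOn S r u) {t : ℝ}
    (ht : t ∈ S) : MemBoundedHolder r (u t) :=
  lt_of_le_of_lt (le_iSup₂ (f := fun t (_ : t ∈ S) => eBoundedHolderNorm r (u t)) t ht) hu

/-- `MemLpHolder` unfolds to a.e. membership and finiteness of the norm. [folklore] -/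
theorem MemLpHolder.eLpHolderNorm_lt_top {p : ℝ≥0∞} (hu : MemLpHolder p r u S) :
    eLpHolderNorm p r u S < ∞ :=
  hu.2

/-- A space–time Hölder field is Hölder in space at each fixed time `t ∈ [0,T]`. [folklore] -/
theorem HolderOnSpaceTime.memHolder {T : ℝ} (hu : HolderOnSpaceTime r T u) {t : ℝ}
    (ht : t ∈ Icc 0 T) : MemHolder r (u t) := by
  obtain ⟨C, hC⟩ := hu
  refine ⟨C, fun x y => ?_⟩
  have h := hC (t, x) ⟨ht, mem_univ _⟩ (t, y) ⟨ht, mem_univ _⟩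
  simpa [Prod.edist_eq] using h

end SpaceTime

section SpaceTimeMetric

variable [MetricSpace X] [NormedAddCommGroup Y] {S : Set ℝ} {r : ℝ≥0} {u : ℝ → X → Y}

/-- `C⁰_t C^{0,r}_x ⊆ L^∞_t C^{0,r}_x` on compact time sets: a norm-continuous map on a compact
set has bounded range (De Lellis–Székelyhidi 2013, §2). Stated under `[MetricSpace X]`, where the
triangle inequality `eBoundedHolderNorm_add_le` is available. Elementary (local boundedness plus
compactness), recorded as a fact pending its proof (librarian SWEEP debt).
[cite: DeLellisSzekelyhidiInvent2013, §2 (Hölder spaces)] -/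
def ContinuousInHolderOn.holderUniformlyBoundedOn : Prop :=
  ∀ {S : Set ℝ} {r : ℝ≥0} {u : ℝ → X → Y}, ContinuousInHolderOn S r u → IsCompact S →
    HolderUniformlyBoundedOn S r u

/-- Discharge of `ContinuousInHolderOn.holderUniformlyBoundedOn`: `C⁰_t C^{0,r}_x ⊆ L^∞_t C^{0,r}_x`
on compact time sets. Proof: for `t₀ ∈ S`, norm-continuity within `S` gives a neighbourhood on
which `‖u t - u t₀‖_{C^{0,r}} ≤ 1`, hence `‖u t‖_{C^{0,r}} ≤ 1 + ‖u t₀‖_{C^{0,r}} < ∞` by the triangle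
inequality `eBoundedHolderNorm_add_le`; compactness (`IsCompact.induction_on`) patches finitely
many such local bounds into a uniform one. The Hölder-norm conventions (`‖f‖_α = ‖f‖_0 + [f]_α`,
spatial norms "understood to be uniform in time") are those of De Lellis–Székelyhidi,
arXiv:1202.1751 §5 p. 11 and §6 p. 13 (= Invent. Math. 193 (2013)).
[cite: DeLellisSzekelyhidiInvent2013, §5 (Hölder norms) and §6 (norms uniform in time)] -/
theorem ContinuousInHolderOn.holderUniformlyBoundedOn_holds :
    ContinuousInHolderOn.holderUniformlyBoundedOn (X := X) (Y := Y) := by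
  intro S r u hu hS
  -- local-to-global via compactness, for the predicate "uniformly bounded on `A`"
  suffices h : ∃ C : ℝ≥0∞, C < ∞ ∧ ∀ t ∈ S, eBoundedHolderNorm r (u t) ≤ C by
    obtain ⟨C, hC, hb⟩ := h
    exact lt_of_le_of_lt (iSup₂_le hb) hC
  refine hS.induction_on
    (p := fun A => ∃ C : ℝ≥0∞, C < ∞ ∧ ∀ t ∈ A, eBoundedHolderNorm r (u t) ≤ C) ?_ ?_ ?_ ?_
  · exact ⟨0, ENNReal.zero_lt_top, fun t ht => ht.elim⟩
  · rintro A B hAB ⟨C, hC, hb⟩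
    exact ⟨C, hC, fun x hx => hb x (hAB hx)⟩
  · rintro A B ⟨C, hC, hb⟩ ⟨D, hD, hb'⟩
    refine ⟨C + D, ENNReal.add_lt_top.2 ⟨hC, hD⟩, fun x hx => ?_⟩
    rcases hx with hx | hx
    · exact (hb x hx).trans le_self_add
    · exact (hb' x hx).trans le_add_self
  · intro t₀ ht₀
    have hmem : {t | eBoundedHolderNorm r (u t - u t₀) < 1} ∈ 𝓝[S] t₀ :=
      (hu.2 t₀ ht₀) (Iio_mem_nhds zero_lt_one)
    refine ⟨_, hmem, 1 + eBoundedHolderNorm r (u t₀), ?_, fun t ht => ?_⟩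
    · exact ENNReal.add_lt_top.2 ⟨ENNReal.one_lt_top, hu.1 t₀ ht₀⟩
    · have hsplit : u t = (u t - u t₀) + u t₀ := (sub_add_cancel (u t) (u t₀)).symm
      calc eBoundedHolderNorm r (u t)
          = eBoundedHolderNorm r ((u t - u t₀) + u t₀) := by rw [← hsplit]
        _ ≤ eBoundedHolderNorm r (u t - u t₀) + eBoundedHolderNorm r (u t₀) :=
            eBoundedHolderNorm_add_le _ _
        _ ≤ 1 + eBoundedHolderNorm r (u t₀) := by gcongr; exact le_of_lt ht

end SpaceTimeMetric

end Literature.Analysis.FunctionSpaces
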